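import Literature.Analysis.FunctionSpaces.GuichardetUHF
import Literature.Analysis.FunctionSpaces.GuichardetUHFProofs
import Literature.MathematicalPhysics.QuantumLattice.CStarStateProofs
import Literature.MathematicalPhysics.QuantumLattice.CStarStateCompactProofs
import HarnessLib

/-!
# The vacuum product state of the UHF algebra on the Guichardet space is pure

Companion to `Literature.Analysis.FunctionSpaces.GuichardetUHF` (notions `quasi_local_algebra`,
`cstar_state_gns`). That file builds the quasi-local C⋆-algebra
`𝔄 = quasiLocalAlg d q hstar ⊆ B(𝓗)` on the Guichardet space `𝓗 = ℓ²(FinSuppConfig d q)`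
(von Neumann's incomplete infinite tensor product `⊗_{x ∈ ℤ^d} (ℂ^q, e₀)`), the local
⋆-homomorphisms `ι_Λ = localRepCod hstar Λ : 𝔄_Λ = M_{q^|Λ|}(ℂ) → 𝔄`, `A ↦ A ⊗ 𝟙_{Λᶜ}`, and the
vacuum vector state `vacuumState d q hstar = ω_Ω`, `Ω = ⊗_x e₀ = δ_{σ ≡ 0}`, and leaves as the
named fact

* `Literature.Analysis.FunctionSpaces.vacuumState_isPure : Prop` — for the C⋆-order of `𝔄`
  (instance hypothesis `[StarOrderedRing ↥𝔄]`), `ω_Ω` is a pure state, i.e. an extreme point of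
  the state space `E_𝔄 ⊆ WeakDual ℂ 𝔄` (`Literature.MathematicalPhysics.QuantumLattice.IsPureState`).

This file proves it: `Literature.Analysis.FunctionSpaces.vacuumState_isPure_holds`.

## The source and the printed argument

A. Guichardet, *Produits tensoriels infinis et représentations des relations d'anticommutation*,
Ann. Sci. ÉNS (3) 83 (1966) 1–52, Chap. 2, §2.5 (Produits tensoriels d'états), p. 24:
**Proposition 2.9** — for states `fᵢ` on C⋆-algebras `Aᵢ` with canonical (GNS) representations
`πᵢ` and cyclic unit vectors `ξᵢ` there is a unique state `⊗fᵢ` on `⊗Aᵢ` with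
`(⊗fᵢ)(⊗xᵢ) = ∏ fᵢ(xᵢ)`, and the representation canonically associated with `⊗fᵢ` is
equivalent to the infinite tensor product representation `⊗^{ξᵢ} πᵢ` on `⊗^{ξᵢ} Hᵢ` with
cyclic vector `⊗ξᵢ`; **Corollaire 2.2** — "L'état `⊗fᵢ` est pur si et seulement si chaque `fᵢ`
est pur." Guichardet's proof combines Prop. 2.9 with §2.4 Corollaire 2.1 ("la représentation
`⊗πᵢ` est … irréductible si et seulement si toutes les `πᵢ` le sont", from the commutation
theorem Prop. 1.6 for tensor products of von Neumann algebras) and "pure ⇔ GNS-irreducible".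
Here `Aₓ = M_q(ℂ)`, `fₓ = ⟨e₀, · e₀⟩` (a vector state of the irreducible identity
representation, hence pure), `⊗^{e₀} ℂ^q` is the Guichardet space and `ω_Ω = ⊗fₓ` is the vacuum
vector state; Bratteli–Robinson I discuss the same objects in Example 2.6.12 and §2.7.2
(infinite tensor products `⊗^{Ω_α} 𝔥_α`, product states `ω(⊗A_α) = ∏(Ω_α, A_α Ω_α)`,
reference [Gui 1]) and prove "pure ⇔ extremal ⇔ GNS irreducible" as Theorem 2.3.19.

## The Lean transcription

We prove extremality of `ω = ω_Ω` in `E_𝔄` directly, by the majorisation argument of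
Bratteli–Robinson I Thm. 2.3.19 run on the explicit product vector `Ω`, which for this vector
state needs neither the GNS space nor the commutation theorem:

1. *Local vacuum projections.* `P_Λ = ι_Λ(E₀₀)`, `E₀₀ = |e₀^{⊗Λ}⟩⟨e₀^{⊗Λ}|` the matrix unit at the
   reference configuration, is a projection of `𝔄` with `ω(ι_Λ A) = A₀₀`
   (`vacuumState_apply_localRepCod`: `Ω = δ₀` and `(π_Λ(A) δ₀)(0) = A₀₀`), so `ω(P_Λ) = 1` and
   `ω(𝟙 - P_Λ) = 0`, while `𝟙 - P_Λ = (𝟙 - P_Λ)⋆(𝟙 - P_Λ) ≥ 0`.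
2. *Majorisation.* If `ω = a φ₁ + b φ₂` in `E_𝔄` with `a, b > 0`, then
   `a φ₁(𝟙 - P_Λ) + b φ₂(𝟙 - P_Λ) = 0` with both terms `≥ 0`, so `φ₁(𝟙 - P_Λ) = 0` for every `Λ`.
3. *Cauchy–Schwarz* (BR I Lemma 2.3.10 (b), `State.norm_apply_star_mul_sq_le_holds`): a state `ρ`
   with `ρ(Q) = 0` for a projection `Q` kills `Q𝔄` and `𝔄Q`, hence `ρ(T) = ρ(P T P)`, `P = 𝟙 - Q`
   (`state_apply_eq_apply_conj_of_apply_compl_eq_zero`).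
4. *Reduction by the vacuum projection.* `E₀₀ A E₀₀ = A₀₀ E₀₀` in `M_{q^|Λ|}(ℂ)`, so
   `P_Λ ι_Λ(A) P_Λ = A₀₀ P_Λ` and `ρ(ι_Λ A) = A₀₀ ρ(P_Λ) = A₀₀ = ω(ι_Λ A)`: `ρ = ω` on every
   `ι_Λ(𝔄_Λ)` (`state_eq_vacuumState_of_apply_compl_vacuumProj_eq_zero`).
5. *Density.* `⋃_Λ ι_Λ(𝔄_Λ)` is dense in `𝔄` (`dense_iUnion_range_localRepCod` with the isotony
   discharge `localRep_compatible_holds`) and states are continuous, so `ρ = ω`; with `ρ = φ₁`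
   this is extremality (`mem_extremePoints_iff_left` is the definition of `Set.extremePoints`).

## Mathlib search and design notes

* Used from Mathlib: `Matrix.single` with `Matrix.single_mul_mul_single`,
  `Matrix.single_mul_single_same`, `Matrix.conjTranspose_single`, `Matrix.smul_single`;
  `lp.inner_single_left`; `star_mul_self_nonneg`; `Continuous.ext_on`; `Complex.nonneg_iff`.
  From `Literature`: `State.norm_apply_star_mul_sq_le_holds` (Cauchy–Schwarz for states),
  `exists_state_toWeakDual_eq` (points of `E_𝔄` are bundled states), `localRepCLM_single_splice`,
  `localRep_compatible_holds`, `dense_iUnion_range_localRepCod`.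
* No definition is added; the fact stays a `def … : Prop` and users obtain it from
  `vacuumState_isPure_holds d q hstar`.
-/

noncomputable section

open scoped ComplexOrder InnerProductSpace

namespace Literature.Analysis.FunctionSpaces

section CauchySchwarz

open Literature.MathematicalPhysics.QuantumLattice

variable {A : Type*} [CStarAlgebra A] [PartialOrder A] [StarOrderedRing A]

/-- Cauchy–Schwarz consequence for a state `ρ`: if `ρ (x⋆ x) = 0` then `ρ (x⋆ y) = 0` for all `y`
(`|ρ(x⋆ y)|² ≤ ρ(x⋆ x) ρ(y⋆ y)`, Bratteli–Robinson I Lemma 2.3.10 (b)).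
[cite: BratteliRobinsonI1987, Lemma 2.3.10(b)] -/
theorem state_apply_star_mul_eq_zero_left (ρ : State A) {x : A} (hx : ρ (star x * x) = 0)
    (y : A) : ρ (star x * y) = 0 := by
  have h := State.norm_apply_star_mul_sq_le_holds ρ x y
  rw [hx, Complex.zero_re, zero_mul] at h
  exact norm_eq_zero.mp ((pow_eq_zero_iff two_ne_zero).mp (le_antisymm h (sq_nonneg _)))

/-- Cauchy–Schwarz consequence for a state `ρ`: if `ρ (x⋆ x) = 0` then `ρ (y⋆ x) = 0` for all `y`
(`|ρ(y⋆ x)|² ≤ ρ(y⋆ y) ρ(x⋆ x)`, Bratteli–Robinson I Lemma 2.3.10 (b)).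
[cite: BratteliRobinsonI1987, Lemma 2.3.10(b)] -/
theorem state_apply_star_mul_eq_zero_right (ρ : State A) {x : A} (hx : ρ (star x * x) = 0)
    (y : A) : ρ (star y * x) = 0 := by
  have h := State.norm_apply_star_mul_sq_le_holds ρ y x
  rw [hx, Complex.zero_re, mul_zero] at h
  exact norm_eq_zero.mp ((pow_eq_zero_iff two_ne_zero).mp (le_antisymm h (sq_nonneg _)))

/-- **Reduction by a projection carrying the state.** If `P = P⋆ = P²` is a projection of a unital
C⋆-algebra and the state `ρ` vanishes on `𝟙 - P`, then `ρ(T) = ρ(P T P)` for every `T`: with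
`Q = 𝟙 - P = Q⋆ Q`, Cauchy–Schwarz gives `ρ(Q T) = 0 = ρ(P T Q)`, and `T = P T P + Q T + P T Q`.
This is the step "`ρ(B*A) = (P Ω, π(B*A) Ω)` is determined by the range of `P`" of
Bratteli–Robinson I Thm. 2.3.19, via Lemma 2.3.10 (b). [cite: BratteliRobinsonI1987, Lemma 2.3.10(b)] -/
theorem state_apply_eq_apply_conj_of_apply_compl_eq_zero (ρ : State A) {P : A}
    (hPstar : star P = P) (hPP : P * P = P) (hρ : ρ (1 - P) = 0) (T : A) :
    ρ T = ρ (P * T * P) := by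
  set Q : A := 1 - P with hQ
  have hQstar : star Q = Q := by rw [hQ, star_sub, star_one, hPstar]
  have hQQ : Q * Q = Q := by
    rw [hQ, sub_mul, one_mul, mul_sub, mul_one, hPP, sub_self, sub_zero]
  have hρQ : ρ (star Q * Q) = 0 := by rwa [hQstar, hQQ]
  have h1 : ρ (Q * T) = 0 := by
    simpa only [hQstar] using state_apply_star_mul_eq_zero_left ρ hρQ T
  have h2 : ρ (P * T * Q) = 0 := by
    simpa only [star_star] using state_apply_star_mul_eq_zero_right ρ hρQ (star (P * T))
  have hT : T = P * T * P + (Q * T + P * T * Q) := by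
    rw [hQ]; noncomm_ring
  conv_lhs => rw [hT]
  rw [map_add, map_add, h1, h2, add_zero, add_zero]

end CauchySchwarz

section QLattice

open Literature.MathematicalPhysics.QuantumLattice (Op State stateSpace IsPureState
  exists_state_toWeakDual_eq)
open Literature.Probability.LatticeModels (Site)

variable {d q : ℕ} [NeZero q]
variable (hstar : localRep_map_star' (d := d) (q := q))

/-- The reference configuration restricted to a finite region is the reference block
(definitional). Bratteli–Robinson II §6.2.1. [folklore] -/
theorem FinSuppConfig.restrict_zero (Λ : Finset (Site d)) :
    (0 : FinSuppConfig d q).restrict Λ = 0 := rfl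

/-- Splicing the reference block into the reference configuration does nothing:
`(⊗_x e₀ with e₀^{⊗Λ} inserted in Λ) = ⊗_x e₀`. Bratteli–Robinson II §6.2.1. [folklore] -/
theorem FinSuppConfig.zero_splice_zero (Λ : Finset (Site d)) :
    (0 : FinSuppConfig d q).splice Λ 0 = 0 := by
  refine FinSuppConfig.ext fun x => ?_
  rw [FinSuppConfig.splice_apply]
  split_ifs <;> rfl

/-- **The vacuum state on local observables**: `ω_Ω(ι_Λ A) = ⟨e₀^{⊗Λ}, A e₀^{⊗Λ}⟩ = A₀₀`, the
product-state formula `(⊗fₓ)(⊗xᵢ) = ∏ fₓ(xₓ)` of Guichardet (1966) Prop. 2.9 for the vector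
states `fₓ = ⟨e₀, · e₀⟩` (equivalently Bratteli–Robinson I §2.7.2,
`ω(⊗A_α) = ∏(Ω_α, A_α Ω_α)`), evaluated on `A ⊗ 𝟙_{Λᶜ}`: `Ω = δ₀` and `(π_Λ(A) δ₀)(0) = A₀₀`
(`localRepCLM_single_splice`). [cite: Guichardet1966, Prop. 2.9] -/
theorem vacuumState_apply_localRepCod (Λ : Finset (Site d)) (A : Op ↥Λ q) :
    vacuumState d q hstar (localRepCod hstar Λ A) = A 0 0 := by
  rw [vacuumState, vectorState_apply, coe_localRepCod_apply, localRep_apply, vacuumVector,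
    lp.inner_single_left]
  have h := localRepCLM_single_splice Λ A (0 : ↥Λ → Fin q) 0
  rw [FinSuppConfig.zero_splice_zero] at h
  rw [h]
  simp

/-- `ω_Ω` vanishes on the complement `𝟙 - P_Λ` of the local vacuum projection
`P_Λ = ι_Λ(E₀₀)`, `E₀₀ = |e₀^{⊗Λ}⟩⟨e₀^{⊗Λ}|` (since `ω_Ω(P_Λ) = (E₀₀)₀₀ = 1`). Guichardet (1966)
Prop. 2.9 (product-state formula); Bratteli–Robinson I §2.7.2. [cite: Guichardet1966, Prop. 2.9] -/
theorem vacuumState_apply_compl_vacuumProj (Λ : Finset (Site d)) :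
    vacuumState d q hstar (1 - localRepCod hstar Λ (Matrix.single 0 0 1)) = 0 := by
  rw [map_sub, State.map_one, vacuumState_apply_localRepCod, Matrix.single_apply_same, sub_self]

/-- The matrix unit `E₀₀ = |e₀^{⊗Λ}⟩⟨e₀^{⊗Λ}|` is a selfadjoint idempotent, and so is its image
`P_Λ = ι_Λ(E₀₀)` under the ⋆-homomorphism `ι_Λ`: `P_Λ⋆ = P_Λ` and `P_Λ² = P_Λ`.
Bratteli–Robinson I Example 2.6.12 (`𝔄_Λ = 𝓛(𝓗_Λ)` full matrix algebras). [folklore] -/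
theorem star_vacuumProj_and_sq (Λ : Finset (Site d)) :
    star (localRepCod hstar Λ (Matrix.single (0 : ↥Λ → Fin q) 0 (1 : ℂ))) =
        localRepCod hstar Λ (Matrix.single 0 0 1) ∧
      localRepCod hstar Λ (Matrix.single (0 : ↥Λ → Fin q) 0 (1 : ℂ)) *
          localRepCod hstar Λ (Matrix.single 0 0 1) =
        localRepCod hstar Λ (Matrix.single 0 0 1) := by
  constructor
  · rw [← map_star, Matrix.star_eq_conjTranspose, Matrix.conjTranspose_single, star_one]
  · rw [← map_mul, Matrix.single_mul_single_same, mul_one]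

/-- The complement `𝟙 - P_Λ` of the local vacuum projection is positive in the C⋆-order of `𝔄`
(`𝟙 - P_Λ = (𝟙 - P_Λ)⋆ (𝟙 - P_Λ)`; Bratteli–Robinson I Thm. 2.2.12, `A ≥ 0 ⇔ A = B⋆B`).
[cite: BratteliRobinsonI1987, Thm. 2.2.12] -/
theorem compl_vacuumProj_nonneg [StarOrderedRing ↥(quasiLocalAlg d q hstar)]
    (Λ : Finset (Site d)) :
    (0 : ↥(quasiLocalAlg d q hstar)) ≤ 1 - localRepCod hstar Λ (Matrix.single 0 0 1) := by
  obtain ⟨hPstar, hPP⟩ := star_vacuumProj_and_sq hstar Λ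
  set P := localRepCod hstar Λ (Matrix.single (0 : ↥Λ → Fin q) 0 (1 : ℂ)) with hP
  have hQ : star (1 - P) * (1 - P) = 1 - P := by
    rw [star_sub, star_one, hPstar, sub_mul, one_mul, mul_sub, mul_one, hPP, sub_self, sub_zero]
  rw [← hQ]
  exact star_mul_self_nonneg (1 - P)

/-- **A state carried by every local vacuum projection is the vacuum state.** If a state `ρ` of
`𝔄` satisfies `ρ(𝟙 - P_Λ) = 0` for all finite `Λ`, then `ρ = ω_Ω`. On local observables:
`ρ(ι_Λ A) = ρ(P_Λ ι_Λ(A) P_Λ)` (Cauchy–Schwarz reduction), `P_Λ ι_Λ(A) P_Λ = ι_Λ(E₀₀ A E₀₀) =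
A₀₀ P_Λ`, and `ρ(P_Λ) = 1`, so `ρ(ι_Λ A) = A₀₀ = ω_Ω(ι_Λ A)`; then `⋃_Λ ι_Λ(𝔄_Λ)` is dense in `𝔄`
and states are continuous. This is the majorisation step of Bratteli–Robinson I Thm. 2.3.19
((1) ⇒ (2): a positive functional majorised by `ω_Ω` is a multiple of `ω_Ω`) for the product
vector `Ω = ⊗ e₀` of Guichardet (1966) Prop. 2.9 / Cor. 2.2. [cite: Guichardet1966, Cor. 2.2] -/
theorem state_eq_vacuumState_of_apply_compl_vacuumProj_eq_zero
    [StarOrderedRing ↥(quasiLocalAlg d q hstar)] (ρ : State ↥(quasiLocalAlg d q hstar))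
    (hρ : ∀ Λ : Finset (Site d), ρ (1 - localRepCod hstar Λ (Matrix.single 0 0 1)) = 0) :
    ρ = vacuumState d q hstar := by
  -- agreement on the local observables `ι_Λ(𝔄_Λ)`
  have hloc : ∀ (Λ : Finset (Site d)) (A : Op ↥Λ q),
      ρ (localRepCod hstar Λ A) = vacuumState d q hstar (localRepCod hstar Λ A) := by
    intro Λ A
    obtain ⟨hPstar, hPP⟩ := star_vacuumProj_and_sq hstar Λ
    have hEAE : Matrix.single (0 : ↥Λ → Fin q) 0 (1 : ℂ) * A * Matrix.single 0 0 1 =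
        A 0 0 • Matrix.single (0 : ↥Λ → Fin q) 0 (1 : ℂ) := by
      rw [Matrix.single_mul_mul_single, Matrix.smul_single, smul_eq_mul, one_mul]
    have hP1 : ρ (localRepCod hstar Λ (Matrix.single 0 0 1)) = 1 := by
      have h := hρ Λ
      rw [map_sub, State.map_one, sub_eq_zero] at h
      exact h.symm
    rw [state_apply_eq_apply_conj_of_apply_compl_eq_zero ρ hPstar hPP (hρ Λ), ← map_mul,
      ← map_mul, hEAE, map_smul, map_smul, hP1, vacuumState_apply_localRepCod, smul_eq_mul,
      mul_one]
  -- density of `⋃_Λ ι_Λ(𝔄_Λ)` in `𝔄` and continuity of states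
  have hdense := dense_iUnion_range_localRepCod d q hstar localRep_compatible_holds
  have hρc : Continuous (ρ : ↥(quasiLocalAlg d q hstar) → ℂ) :=
    map_continuous ρ.toPositiveLinearMap
  have hωc : Continuous (vacuumState d q hstar : ↥(quasiLocalAlg d q hstar) → ℂ) :=
    map_continuous (vacuumState d q hstar).toPositiveLinearMap
  refine DFunLike.coe_injective (Continuous.ext_on hdense hρc hωc fun T hT => ?_)
  obtain ⟨Λ, hΛ⟩ := Set.mem_iUnion.1 hT
  obtain ⟨A, rfl⟩ := hΛ
  exact hloc Λ A

variable (d q) in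
/-- **The vacuum product state is pure** (discharge of the named fact `vacuumState_isPure`): the
vector state `ω_Ω`, `Ω = ⊗_x e₀`, of the quasi-local (UHF) algebra `𝔄` on the Guichardet space
is an extreme point of the state space `E_𝔄`. Guichardet (1966), Chap. 2 §2.5, Corollaire 2.2
("L'état `⊗fᵢ` est pur si et seulement si chaque `fᵢ` est pur") with Proposition 2.9 (the state
`⊗fᵢ` is the vector state of `⊗ξᵢ` in `⊗^{ξᵢ} πᵢ`), for `Aₓ = M_q(ℂ)` and the pure vector states
`fₓ = ⟨e₀, · e₀⟩`; Bratteli–Robinson I Example 2.6.12, §2.7.2 and Thm. 2.3.19 (pure ⇔ extremal).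
Proof: if `ω_Ω = a φ₁ + b φ₂` in `E_𝔄`, `a, b > 0`, then `φ₁` vanishes on every `𝟙 - P_Λ ≥ 0`
(as `ω_Ω` does), hence `φ₁ = ω_Ω` by
`state_eq_vacuumState_of_apply_compl_vacuumProj_eq_zero`. [cite: Guichardet1966, Cor. 2.2] -/
theorem vacuumState_isPure_holds : vacuumState_isPure d q hstar := by
  intro _inst
  refine ⟨(vacuumState d q hstar).toWeakDual_mem_stateSpace, ?_⟩
  rintro φ₁ hφ₁ φ₂ hφ₂ ⟨a, b, ha, hb, _hab, hsum⟩
  obtain ⟨ρ, rfl⟩ := exists_state_toWeakDual_eq hφ₁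
  refine congrArg State.toWeakDual
    (state_eq_vacuumState_of_apply_compl_vacuumProj_eq_zero hstar ρ fun Λ => ?_)
  set Q : ↥(quasiLocalAlg d q hstar) := 1 - localRepCod hstar Λ (Matrix.single 0 0 1) with hQ
  have hQ0 : 0 ≤ Q := compl_vacuumProj_nonneg hstar Λ
  have h := DFunLike.congr_fun hsum Q
  change a • ρ.toWeakDual Q + b • φ₂ Q = (vacuumState d q hstar).toWeakDual Q at h
  rw [State.toWeakDual_apply, State.toWeakDual_apply, vacuumState_apply_compl_vacuumProj,
    Complex.real_smul, Complex.real_smul] at h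
  obtain ⟨h1re, h1im⟩ := Complex.nonneg_iff.1 (ρ.map_nonneg hQ0)
  obtain ⟨h2re, _h2im⟩ := Complex.nonneg_iff.1 (hφ₂.1 Q hQ0)
  have hre := congrArg Complex.re h
  simp only [Complex.add_re, Complex.re_ofReal_mul, Complex.zero_re] at hre
  apply Complex.ext
  · rw [Complex.zero_re]
    nlinarith [mul_nonneg ha.le h1re, mul_nonneg hb.le h2re, mul_pos ha hb]
  · rw [Complex.zero_im]
    exact h1im.symm

end QLattice

end Literature.Analysis.FunctionSpaces
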